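import Summits.BirchSwinnertonDyer.BirchSwinnertonDyer.Theorems.KatoDescentPotSupersingularWildFineSelmerCMFineUnitAnchor
import Summits.BirchSwinnertonDyer.BirchSwinnertonDyer.Theorems.KatoDescentTamePotSupersingularTameFineSelmerFineUnitAnchorTamagawa
import HarnessLib

/-!
# Route `KatoDescentTamePotSupersingular` (rung K8-t′, cell `bsd-potss`): the CM FINE UNIT-ANCHOR road for the
# (t′) Conj-A crux `TameFineSelmerCoatesSujatha` (item stmt-BirchSwinnertonDyer-19413) at an odd additive
# potentially-good prime `p` — twin of the K9 file `…WildFineSelmerCMFineUnitAnchor.lean`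
# (a `--supports … --as helper` file; seat `bsd-potss-conjA-anchor` g3 = the census seat, COURTESY LANDING by
# a prover seat for `bsd-potss-k8t-c4`; ROUTE-FREE; nothing booked, BSD is not proved by any of this)

WHY. On the (t′) rows of 19413 every congruent partner is additive at `p` (local irreducibility); the fine
unit-anchor road (`TameFineSelmerFineUnitAnchor`, p480932; Tamagawa socket p482336) serves them with a
rank-`0` anchor having `Ш[p] = 0`. The census of this seat (`FINE-CENSUS-rows-conjA-anchor-g3.tsv`) finds, next to
the small-conductor anchors (bsd.S31), rows whose only qualifying partner of conductor `≥ 5000` is a CM curve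
(the `j = 0 / 1728` twists `11025d`, `14400u/da`, `216225bp`, … at `p = 5`; `3·d`-twists at `p = 3`): for those,
Burungale–Flach's BSD formula (bsd.S28, `bsdTriple_of_hasCM_of_L_one_ne_zero`) turns `r_an(E′) = 0` and
`p ∤ Ш_an(E′)` into `rank 0` and `#Ш(E′)[p^∞] = 1`
(`WildFineSelmerCMFineUnitAnchor.natCard_primaryComponent_sha_eq_one_of_hasCM`).

* **`missingUpperBoundAt_addv_of_cmFineUnitAnchor`** (torsion sockets) and **`…_tamagawa`**
  (`p ∤ ∏ c_ℓ(E′)` + the torsion test at the places above `p` only — vacuous in content on (t′) rows, where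
  `E′(ℚ_p)[p] = W(ℚ_p)[p] = 0` by local irreducibility, but kept as the displayed hypothesis of the road).
* `missingUpperBoundAt_addv_of_smallConductorFineUnitAnchor_tamagawa` — bsd.S31 anchor + Tamagawa socket (completeness).
* `tameFineSelmerCoatesSujatha_of_cmFineAnchorCertificates` — the crux BODY from per-row certificates.

HONEST FRAMING: conditional-results on displayed named facts (`hLS`, `hKatoA`, GZK, modularity; bsd.S28 on the
anchor side — all typed in the tree, no new fact); per-row data are hypotheses (census data of record); item
19413 is NOT closed; class-wide the crux is Coates–Sujatha (A), a named open problem. References: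
[BurungaleFlach2024] Thm. 1.1, Cor. 2; [GreenbergLNM1716] Prop. 3.8 (pp. 95–96); [LimSujatha2018] §3 Prop. 3.2;
[Kato2004Asterisque] Thm. 14.5 (3) (p. 236), Prop. 14.16 (2) (p. 244); [CoatesSujatha2005] §3.
-/

set_option autoImplicit false
-- sibling precedent (`KatoDescentPotSupersingularAssembly.lean`): the directory name repeats the summit name
set_option linter.dupNamespace false

noncomputable section

open scoped Classical

universe u

namespace Summit.BirchSwinnertonDyer.BirchSwinnertonDyer.Theorems.TameFineSelmerCMFineUnitAnchor

open NumberField IsDedekindDomain Field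
open WeierstrassCurve Literature.NumberTheory.EllipticCurves
  Literature.NumberTheory.EllipticCurves.GreenbergSelmer
  Literature.NumberTheory.EllipticCurves.IwasawaAlgebra
  Literature.NumberTheory.EllipticCurves.Rank1Residual
  Literature.NumberTheory.EllipticCurves.Rank1Residual.Typed
  Literature.NumberTheory.EllipticCurves.ZpExtension
  Summit.BirchSwinnertonDyer.Rank1Residual Summit.BirchSwinnertonDyer.Rank1Residual.Additive
  Summit.BirchSwinnertonDyer.Rank1Residual.O6 Summit.BirchSwinnertonDyer.Rank1Residual.Iwasawa
  Summit.BirchSwinnertonDyer.BirchSwinnertonDyer.Theorems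

/-- **THE CM FINE UNIT-ANCHOR ROAD at an additive potentially-good odd prime, row form (K8-t′ twin).**
`W/ℚ` globally minimal, `r_an = 0`, `p` odd, `Addv W p`, `0 ≤ ord_p j`, `W[p]` irreducible; `W′/ℚ` globally minimal
WITH CM, `W′[p] ≅ W[p]` (any reduction at `p`, any conductor), `r_an(W′) = 0`, `Ш_an(W′) = m`, `p ∤ m`, and no
non-zero `D_v`-fixed `p`-torsion of `W′[p^∞]` for `v` in a finite `S` off which `W′` is good and `v ∤ p`.
Then `MissingUpperBoundAt W p`. [cite: BurungaleFlach2024, Thm. 1.1 and Cor. 2]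
[cite: GreenbergLNM1716, Prop. 3.8 (pp. 95–96)] [cite: LimSujatha2018, §3 Prop. 3.2]
[cite: Kato2004Asterisque, Thm. 14.5 (3) (p. 236) and Prop. 14.16 (2) (p. 244)] -/
theorem missingUpperBoundAt_addv_of_cmFineUnitAnchor
    (hLS : LimSujatha2018.prop32_fineSelmerDual_moduleFinite_iff_of_torsionIso)
    (hKatoA :
      Kato2004.rankZero_padicValNat_sha_add_padicValNat_tamagawa_le_of_additive_potGood_of_irreducible_of_fineSelmerDual_fg)
    (hGZK : rank_eq_analyticRank_of_analyticRank_le_one) (hmod : hasEntireLFunction_rat)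
    (hS28 : bsdTriple_of_hasCM_of_L_one_ne_zero)
    (W : WeierstrassCurve ℚ) [W.IsElliptic] [W.IsGloballyMinimal] (p : ℕ) [Fact p.Prime]
    (hr : W.analyticRank = 0) (hp : p ≠ 2) (hA : Addv W p) (hj : 0 ≤ padicValRat p W.j)
    (hirr : W.HasIrreducibleModPGaloisRep p)
    (W' : WeierstrassCurve ℚ) [W'.IsElliptic] [W'.IsGloballyMinimal] (hcong : ModPCongruent W' W p)
    (hcm' : W'.HasCM) (hr' : W'.analyticRank = 0) {m : ℕ} (hshaAn' : shaAn W' = (m : ℂ)) (hm : ¬ p ∣ m)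
    (S : Finset (HeightOneSpectrum (𝓞 ℚ)))
    (hS : ∀ v ∉ S, ((p : ℕ) : 𝓞 ℚ) ∉ v.asIdeal ∧ W'.HasGoodReductionAt v)
    (hloc' : ∀ v ∈ S, ∀ x : W'.geomPrimaryTorsion p, p • x = 0 → (∀ d ∈ decomp v, d • x = x) → x = 0) :
    MissingUpperBoundAt W p := by
  obtain ⟨hrank', h1⟩ :=
    WildFineSelmerCMFineUnitAnchor.natCard_primaryComponent_sha_eq_one_of_hasCM hS28 hmod W' p hcm' hr'
      hshaAn' hm
  exact TameFineSelmerFineUnitAnchor.missingUpperBoundAt_addv_of_fineUnitAnchor hLS hKatoA hGZK hmod W p hr hp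
    hA hj hirr W' hcong S hS hrank' h1 hloc'

/-- **The same, Tamagawa form**: `p ∤ ∏ c_ℓ(W′)` replaces the torsion tests at the places `v ∤ p` of `S`
(`TameFineSelmerFineUnitAnchorTamagawa.missingUpperBoundAt_addv_of_fineUnitAnchor_tamagawa`).
[cite: BurungaleFlach2024, Thm. 1.1 and Cor. 2] [cite: GreenbergLNM1716, Prop. 3.8 (pp. 95–96) and §3 Lemma 3.3]
[cite: LimSujatha2018, §3 Prop. 3.2] -/
theorem missingUpperBoundAt_addv_of_cmFineUnitAnchor_tamagawa
    (hLS : LimSujatha2018.prop32_fineSelmerDual_moduleFinite_iff_of_torsionIso)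
    (hKatoA :
      Kato2004.rankZero_padicValNat_sha_add_padicValNat_tamagawa_le_of_additive_potGood_of_irreducible_of_fineSelmerDual_fg)
    (hGZK : rank_eq_analyticRank_of_analyticRank_le_one) (hmod : hasEntireLFunction_rat)
    (hS28 : bsdTriple_of_hasCM_of_L_one_ne_zero)
    (W : WeierstrassCurve ℚ) [W.IsElliptic] [W.IsGloballyMinimal] (p : ℕ) [Fact p.Prime]
    (hr : W.analyticRank = 0) (hp : p ≠ 2) (hA : Addv W p) (hj : 0 ≤ padicValRat p W.j)
    (hirr : W.HasIrreducibleModPGaloisRep p)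
    (W' : WeierstrassCurve ℚ) [W'.IsElliptic] [W'.IsGloballyMinimal] (hcong : ModPCongruent W' W p)
    (hcm' : W'.HasCM) (hr' : W'.analyticRank = 0) {m : ℕ} (hshaAn' : shaAn W' = (m : ℂ)) (hm : ¬ p ∣ m)
    (htam' : ¬ p ∣ W'.tamagawaProduct)
    (S : Finset (HeightOneSpectrum (𝓞 ℚ)))
    (hS : ∀ v ∉ S, ((p : ℕ) : 𝓞 ℚ) ∉ v.asIdeal ∧ W'.HasGoodReductionAt v)
    (hlocp : ∀ v ∈ S, ((p : ℕ) : 𝓞 ℚ) ∈ v.asIdeal →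
      ∀ x : W'.geomPrimaryTorsion p, p • x = 0 → (∀ d ∈ decomp v, d • x = x) → x = 0) :
    MissingUpperBoundAt W p := by
  obtain ⟨hrank', h1⟩ :=
    WildFineSelmerCMFineUnitAnchor.natCard_primaryComponent_sha_eq_one_of_hasCM hS28 hmod W' p hcm' hr'
      hshaAn' hm
  exact TameFineSelmerFineUnitAnchorTamagawa.missingUpperBoundAt_addv_of_fineUnitAnchor_tamagawa hLS hKatoA hGZK
    hmod W p hr hp hA hj hirr W' hcong S hS hrank' h1 htam' hlocp

/-- **Small-conductor fine unit anchor, Tamagawa form (K8-t′ twin)**: `N_{W′} < 5000`, `rank W′(ℚ) = 0`,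
`Ш_an(W′) = m`, `p ∤ m` (bsd.S31), `p ∤ ∏ c_ℓ(W′)`, torsion test at the places above `p` only; then
`MissingUpperBoundAt W p` by `TameFineSelmerFineUnitAnchorTamagawa.missingUpperBoundAt_addv_of_fineUnitAnchor_tamagawa`.
[cite: CreutzMiller2012, Thm. 1.1] [cite: GreenbergLNM1716, Prop. 3.8 (pp. 95–96) and §3 Lemma 3.3]
[cite: LimSujatha2018, §3 Prop. 3.2] -/
theorem missingUpperBoundAt_addv_of_smallConductorFineUnitAnchor_tamagawa
    (hLS : LimSujatha2018.prop32_fineSelmerDual_moduleFinite_iff_of_torsionIso)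
    (hKatoA :
      Kato2004.rankZero_padicValNat_sha_add_padicValNat_tamagawa_le_of_additive_potGood_of_irreducible_of_fineSelmerDual_fg)
    (hGZK : rank_eq_analyticRank_of_analyticRank_le_one) (hmod : hasEntireLFunction_rat)
    (hS31 : bsdTriple_of_rank_le_one_of_conductor_lt)
    (W : WeierstrassCurve ℚ) [W.IsElliptic] [W.IsGloballyMinimal] (p : ℕ) [Fact p.Prime]
    (hr : W.analyticRank = 0) (hp : p ≠ 2) (hA : Addv W p) (hj : 0 ≤ padicValRat p W.j)
    (hirr : W.HasIrreducibleModPGaloisRep p)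
    (W' : WeierstrassCurve ℚ) [W'.IsElliptic] [W'.IsGloballyMinimal] (hcong : ModPCongruent W' W p)
    (hN' : W'.conductorNorm ℤ < 5000) (hrank' : W'.mordellWeilRank = 0)
    {m : ℕ} (hshaAn' : shaAn W' = (m : ℂ)) (hm : ¬ p ∣ m) (htam' : ¬ p ∣ W'.tamagawaProduct)
    (S : Finset (HeightOneSpectrum (𝓞 ℚ)))
    (hS : ∀ v ∉ S, ((p : ℕ) : 𝓞 ℚ) ∉ v.asIdeal ∧ W'.HasGoodReductionAt v)
    (hlocp : ∀ v ∈ S, ((p : ℕ) : 𝓞 ℚ) ∈ v.asIdeal →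
      ∀ x : W'.geomPrimaryTorsion p, p • x = 0 → (∀ d ∈ decomp v, d • x = x) → x = 0) :
    MissingUpperBoundAt W p := by
  obtain ⟨hfin, hcard⟩ :=
    WildFineSelmerSmallConductorAnchor.natCard_sha_eq_of_conductor_lt_of_shaAn_eq hS31 W'
      (by rw [hrank']; exact zero_le_one) hN' hshaAn'
  haveI : Finite W'.sha := hfin
  have h1 : Nat.card (AddCommGroup.primaryComponent W'.sha p) = 1 := by
    rw [card_addPrimaryComponent_eq_pow p, hcard, Nat.factorization_eq_zero_of_not_dvd hm, pow_zero]
  exact TameFineSelmerFineUnitAnchorTamagawa.missingUpperBoundAt_addv_of_fineUnitAnchor_tamagawa hLS hKatoA hGZK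
    hmod W p hr hp hA hj hirr W' hcong S hS hrank' h1 htam' hlocp

/-- **The (t′) crux body from per-row CM FINE-ANCHOR certificates** (class form; the `hcert` currency for the census
seats): via g6's `TameFineSelmerFineUnitAnchor.tameFineSelmerCoatesSujatha_of_fineUnitAnchorCertificates`.
Conditional on `hLS`, modularity and bsd.S28 only; item 19413 is NOT closed.
[cite: LimSujatha2018, §3 Prop. 3.2] [cite: BurungaleFlach2024, Thm. 1.1 and Cor. 2] [cite: CoatesSujatha2005, §3] -/
theorem tameFineSelmerCoatesSujatha_of_cmFineAnchorCertificates
    (hLS : LimSujatha2018.prop32_fineSelmerDual_moduleFinite_iff_of_torsionIso)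
    (hmod : hasEntireLFunction_rat) (hS28 : bsdTriple_of_hasCM_of_L_one_ne_zero)
    (hcert : ∀ (W : WeierstrassCurve ℚ) [W.IsElliptic] [W.IsGloballyMinimal] (p : ℕ) [Fact p.Prime],
      W.analyticRank = 0 → p ≠ 2 → Addv W p → SubTprime W p → W.HasIrreducibleModPGaloisRep p →
      ¬ (∀ n : ℕ, W.HasSurjectiveModNGaloisRep (p ^ n : ℕ)) → ¬ W.HasCM →
      ∃ (W' : WeierstrassCurve ℚ) (_ : W'.IsElliptic) (_ : W'.IsGloballyMinimal) (m : ℕ)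
        (S : Finset (HeightOneSpectrum (𝓞 ℚ))),
        ModPCongruent W' W p ∧ W'.HasCM ∧ W'.analyticRank = 0 ∧ shaAn W' = (m : ℂ) ∧ ¬ p ∣ m ∧
        (∀ v ∉ S, ((p : ℕ) : 𝓞 ℚ) ∉ v.asIdeal ∧ W'.HasGoodReductionAt v) ∧
        (∀ v ∈ S, ∀ x : W'.geomPrimaryTorsion p, p • x = 0 → (∀ d ∈ decomp v, d • x = x) → x = 0)) :
    ∀ (W : WeierstrassCurve ℚ) [W.IsElliptic] [W.IsGloballyMinimal] (p : ℕ) [Fact p.Prime],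
      W.analyticRank = 0 → p ≠ 2 → Addv W p → SubTprime W p → W.HasIrreducibleModPGaloisRep p →
      ¬ (∀ n : ℕ, W.HasSurjectiveModNGaloisRep (p ^ n : ℕ)) → ¬ W.HasCM →
      ∀ (κ : ZpExtension ℚ p), κ.IsCyclotomic →
        ∃ (γ : absoluteGaloisGroup ℚ) (D : W.FineSelmerDualData κ γ),
          Module.Finite ℤ_[p] (RestrictScalars ℤ_[p] (IwasawaAlgebra p) D.X) := by
  refine TameFineSelmerFineUnitAnchor.tameFineSelmerCoatesSujatha_of_fineUnitAnchorCertificates hLS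
    fun W _ _ p _ hr hp hA hT hirr hns hcm ↦ ?_
  obtain ⟨W', hW'e, hW'm, m, S, hcong, hcm', hr', hshaAn', hm, hS, hloc'⟩ := hcert W p hr hp hA hT hirr hns hcm
  haveI := hW'e; haveI := hW'm
  obtain ⟨hrank', h1⟩ :=
    WildFineSelmerCMFineUnitAnchor.natCard_primaryComponent_sha_eq_one_of_hasCM hS28 hmod W' p hcm' hr' hshaAn' hm
  exact ⟨W', hW'e, S, hcong, hS, hrank', h1, hloc'⟩

end Summit.BirchSwinnertonDyer.BirchSwinnertonDyer.Theorems.TameFineSelmerCMFineUnitAnchor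

end
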